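import Literature.Probability.RandomPlanarGeometry.LoewnerDrivingBound
import Literature.Probability.RandomPlanarGeometry.LoewnerSimpleIncrement
import Literature.Probability.RandomPlanarGeometry.KSRectangleExit
import Literature.Probability.Process.HolderNormTightness
import HarnessLib

/-!
# Tails of the driving function from rectangle exits of the curve (Kemppainen–Smirnov, Prop. 3.8)

Topic `Literature/Probability/RandomPlanarGeometry` (family `crit-ising`); theorems only, no
definition and no named fact. Written in support of the named fact
`Literature.Probability.LatticeModels.exists_observableMartingale_fkInterface`
(`LatticeModels/FKIsingObservableMartingale.lean`; Chelkak–Duminil-Copin–Hongler–Kemppainen–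
Smirnov, C. R. Math. 352 (2014), Thm. 2 / Thm. 3), whose remaining lattice input (2) in
`LatticeModels/FKIsingLatticeDataAssembly.lean` is the Kemppainen–Smirnov box tightness of the
discrete Loewner pairs: moduli `δW` of the driving terms, moduli `δγ` of the curves, transience —
the probabilistic half of A. Kemppainen, S. Smirnov, *Random curves, scaling limits and Loewner
evolutions*, Ann. Probab. 45 (2017), §3 (the events `E₁`–`E₄` of §3.5).

This file PROVES the step **Prop. 3.7 ⟹ Prop. 3.8 ⟹ Thm. 3.9 ⟹ (`E₁`, `E₃` of §3.5)** of that
half (arXiv:1212.6215v3, p. 16): "Our primary interest is to estimate the tails of the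
distribution of the increments of the driving process. Let's first study what kind of events are
those when `|W(t) - W(s)|` is large. … Consider a hull `K` that is a subset of a rectangle
`R_{L,u}` … Based on this `P(|W(u²/4)| ≥ 2L) ≤ P(Re[(Φγ)(τ_{R_{L,u}})] = ±L)` (10)", then
Prop. 3.7 "`P(Re[(Φγ)(τ_{R_{L,u}})] = ±L) ≤ K e^{-cL/u}`" (in the tree:
`KSRectangleExit.measure_reach_abs_re_le`), and Prop. 3.8: "(1) Let `b_n = (4/c)√n log(Kn)`.
Then by (10) and (11) `P(sup_{0≤t≤n} |W_t| > b_n) ≤ K exp(-c b_n/(4√n)) = 1/n`. (2) Estimate the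
probability of the complement of `G_n` by the sum
`∑_j P(max_{u ∈ [T(j-1)2^{-n}, Tj2^{-n}]} |W_u - W_{T(j-1)2^{-n}}| > 2^{-αn}) ≤
K 2^n e^{-(c/4) T^{-1/2} 2^{(1/2-α)n}} ≤ 2^{-n}`" — the increments being handled, as in the
printed proof, by applying (10) and Prop. 3.7 to the curve after time `s`, i.e. to the
**increment curve** `β = gₛ(γ̂(s + ·))`, which generates the chain of the increments
`W(s + ·) - W(s)` (the deterministic domain Markov property in the simple phase,
`Loewner.IsGeneratedByCurve.incr_sub`, `LoewnerSimpleIncrement.lean`).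

* Deterministic (namespace `Loewner`): `IsGeneratedByCurve.exists_le_abs_re_of_le_abs_driving`
  (non-strict exit form of KS's (10) with the tree's constant: `581 (L + 2√t) ≤ |W_t|` forces
  `L ≤ |re γ̂(s)|` for some `s ≤ t`, `LoewnerDrivingBound.lean`),
  `IsGeneratedByCurve.exists_le_abs_re_incrCurve_sub` / `…_of_exists` (the same for the
  increments: `581 (L + 2√u) ≤ |W(s+u) - W(s)|`, or `λ ≤ |W(s+r₀) - W(s)|` for some `r₀ ≤ u`
  with `λ > 1162 √u`, forces `β` to leave the strip `W s + {|re| < L}`, `L = λ/581 - 2√u`, by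
  capacity `u`), `IsGeneratedByCurve.im_incrCurve_le_two_mul_sqrt` (`β[0, u]` has height
  `≤ 2√u`), `IsGeneratedByCurve.incrCurve_time_zero` (`β = γ̂` at `s = 0`).
* Tails (random Loewner pairs `(W, γ̂)` on a probability space, a.s. simple generated chains):
  `measure_exists_le_abs_driving_sub_le_of_exitTail` — an exit tail
  `P{∃ r ≤ u, L ≤ |re β(r) - W s|} ≤ K e^{-cL/√u}` gives
  `P{∃ r ≤ u, λ ≤ |W(s+r) - W(s)|} ≤ max(K,1) e^{2c} e^{-(c/581) λ/√u}` (KS Prop. 3.8, core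
  step); fixed-endpoint and time-zero forms; `subexp_tails_of_exitTails` — the two-time tails in
  the format of `Process/HolderNormTightness.lean`.
* `E₁`, `E₃` uniformly in the pair: `exists_drivingBound_of_exitTails` (Prop. 3.8 (1): levels
  `b M` with `P{∃ M, ∃ r ≤ M+1, b M < |W r - W 0|} ≤ ε`, the input of
  `MarkedDomain.IsChordalUniformizing.exists_capRad_of_driving_bound`, `LoewnerRegularCurves.lean`),
  `exists_holderConst_driving_of_exitTails` (Thm. 3.9), `exists_drivingModulus_of_exitTails`
  (`E₃`: one modulus `drvMod T` for all horizons, the clause `IsRegularCurve.driving_modulus`),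
  `exists_drivingScales_of_exitTails` (box scales `δW`, `Process.modulusSet`) — by
  `Process.exists_holderConst/modulus/scales_of_subexp_tails` (KS Prop. 3.8 (2), dyadic chaining).
* The bridge from Prop. 3.7: `exitTail_of_rectangleExit` — if some measurable choice of classes
  of the recentred increment curves `β - W s` on `[0, u]` has a law satisfying the
  boundary-annulus crossing bound `hG` of `KSRectangleExit.measure_reach_abs_re_le` (Condition G2
  in `ℍ` at the pasts avoiding the outer disc; inner radius `2√u`, constant `C`), then the exit
  tail holds with `K = 4`, `c = log 2/(2C)`; whence `exists_drivingBound_of_rectangleExit`,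
  `exists_drivingModulus_of_rectangleExit`, `exists_drivingScales_of_rectangleExit`.

What is NOT here (the remaining input of `E₁`/`E₃` for a lattice model): the crossing bound `hG`
itself for the laws of the recentred increment curves of the discrete interfaces read in `ℍ` —
Condition G2 for the model (for FK-Ising: CDHKS Thm. 4 / KS Prop. 4.3) transported to `ℍ` and
to the curve after a stopping time (KS §2.2, Prop. 2.6: G2 ⟺ C2, conformal invariance of C2).

## References

* A. Kemppainen, S. Smirnov, Ann. Probab. 45 (2017) 698–779, §3.3: eq. (10), Prop. 3.7,
  Prop. 3.8, Thm. 3.9; §3.5 (events `E₁`, `E₃`) (arXiv:1212.6215v3, p. 16, p. 18).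
  [KemppainenSmirnov2017]
* D. Chelkak, H. Duminil-Copin, C. Hongler, A. Kemppainen, S. Smirnov, C. R. Math. Acad. Sci.
  Paris 352 (2014) 157–161, Thm. 3 ("`sup_δ E[exp(ε|W^δ_t|/√t)] < ∞`", "`W^δ` … tight").
  [CDHKSCRAS2014]
* G. F. Lawler, *Conformally Invariant Processes in the Plane*, AMS (2005), §3.4 (3.12), §4.1
  Thm. 4.6, §6.2. [Lawler2005]
-/

noncomputable section

open Set Filter Topology Metric MeasureTheory
open scoped NNReal ENNReal

namespace Literature.Probability.RandomPlanarGeometry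

namespace Loewner

variable {W : ℝ≥0 → ℝ} {γ : ℝ≥0 → ℂ}

/-- **Exit form of Kemppainen–Smirnov's (10), non-strict.** If `581 (L + 2√t) ≤ |W_t|` (`L > 0`)
then `L ≤ |re γ(s)|` for some `s ≤ t`: otherwise the continuous `|re γ|` has a maximum `L₀ < L`
on `[0, t]` and `abs_driving_le_of_abs_re_le` bounds `|W_t| ≤ 581 (max L₀ (L/2) + 2√t) <
581 (L + 2√t)`. [cite: KemppainenSmirnov2017, §3.3 eq. (10)] -/
theorem IsGeneratedByCurve.exists_le_abs_re_of_le_abs_driving (hγ : IsGeneratedByCurve W γ)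
    (hW : Continuous W) {t : ℝ≥0} {L : ℝ} (hL : 0 < L)
    (hWt : 581 * (L + 2 * Real.sqrt t) ≤ |W t|) : ∃ s ≤ t, L ≤ |(γ s).re| := by
  by_contra h
  push Not at h
  have hcont : ContinuousOn (fun s : ℝ≥0 ↦ |(γ s).re|) (Icc 0 t) :=
    (continuous_abs.comp (Complex.continuous_re.comp hγ.1)).continuousOn
  obtain ⟨s₀, hs₀, hmax⟩ :=
    (isCompact_Icc : IsCompact (Icc (0 : ℝ≥0) t)).exists_isMaxOn (nonempty_Icc.2 bot_le) hcont
  set L₀ : ℝ := max |(γ s₀).re| (L / 2) with hL₀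
  have hL₀L : L₀ < L := max_lt (h s₀ hs₀.2) (by linarith)
  have hL₀pos : 0 < L₀ := lt_max_of_lt_right (by linarith)
  have hbound := hγ.abs_driving_le_of_abs_re_le hW hL₀pos fun s hs ↦
    (show |(γ s).re| ≤ |(γ s₀).re| from hmax ⟨bot_le, hs⟩).trans (le_max_left _ _)
  linarith

/-- The driving function of the recentred increment chain `r ↦ W (s + r) - W s` is continuous.
[folklore] -/
theorem continuous_driving_incr (hW : Continuous W) (s : ℝ≥0) :
    Continuous fun r : ℝ≥0 ↦ W (s + r) - W s :=
  (hW.comp (continuous_const.add continuous_id)).sub continuous_const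

section Incr

variable (hγ : IsGeneratedByCurve W γ) (hs : IsSimpleTrace γ) (hW : Continuous W)
include hγ hs hW

/-- At time `0` the increment curve is the curve itself (`g₀ = id` off the driving point, and
`γ(r) ∈ ℍ` for `r > 0`). [folklore] -/
theorem IsGeneratedByCurve.incrCurve_time_zero : incrCurve W γ 0 = γ := by
  funext r
  rcases eq_or_ne r 0 with rfl | hr
  · rw [incrCurve_zero, hγ.2.1]
  · have hr' : 0 < r := pos_iff_ne_zero.2 hr
    rw [incrCurve_of_pos W γ 0 hr', zero_add, map_zero_apply hW]
    intro h
    have him := hs.2 r hr'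
    rw [h] at him
    simp at him

/-- **Height of the increment curve**: `im gₛ(γ(s + r)) ≤ 2 √u` for `r ≤ u` (the height bound
`(im z)² ≤ 4u` on the hull of the increment chain, which is generated by the increment curve,
`IsGeneratedByCurve.incr_sub`). [cite: Lawler2005, Ch. 4 §4.1 Thm. 4.6] -/
theorem IsGeneratedByCurve.im_incrCurve_le_two_mul_sqrt (s : ℝ≥0) {r u : ℝ≥0} (hru : r ≤ u) :
    (incrCurve W γ s r).im ≤ 2 * Real.sqrt u := by
  have h := (hγ.incr_sub hs hW s).im_le_two_mul_sqrt (continuous_driving_incr hW s) hru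
  simpa using h

/-- **Kemppainen–Smirnov's (10) for increments.** If `581 (L + 2√u) ≤ |W (s + u) - W s|`
(`L > 0`) then the increment curve `β = gₛ(γ(s + ·))` satisfies `L ≤ |re β(r) - W s|` for some
`r ≤ u`: the recentred increment chain `W (s + ·) - W s` is generated by `β - W s`
(`IsGeneratedByCurve.incr_sub`, the deterministic domain Markov property in the simple phase)
and `exists_le_abs_re_of_le_abs_driving` applies to it. Together with the height bound
`im_incrCurve_le_two_mul_sqrt`: a large increment of the driving function over `[s, s + u]`
forces `β` to leave the rectangle `W s + [-L, L] × [0, 2√u]` through its vertical sides by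
capacity time `u`. [cite: KemppainenSmirnov2017, §3.3 eq. (10) and Prop. 3.8 (proof)] -/
theorem IsGeneratedByCurve.exists_le_abs_re_incrCurve_sub (s : ℝ≥0) {u : ℝ≥0} {L : ℝ}
    (hL : 0 < L) (hWu : 581 * (L + 2 * Real.sqrt u) ≤ |W (s + u) - W s|) :
    ∃ r ≤ u, L ≤ |(incrCurve W γ s r).re - W s| := by
  obtain ⟨r, hr, hL'⟩ := (hγ.incr_sub hs hW s).exists_le_abs_re_of_le_abs_driving
    (continuous_driving_incr hW s) hL hWu
  refine ⟨r, hr, ?_⟩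
  simpa using hL'

/-- **Running-maximum form.** If `λ ≤ |W (s + r₀) - W s|` for some `r₀ ≤ u`, where
`λ > 1162 √u`, then `λ/581 - 2√u ≤ |re β(r) - W s|` for some `r ≤ u` (apply
`exists_le_abs_re_incrCurve_sub` on `[s, s + r₀]` with `L = λ/581 - 2√r₀ ≥ λ/581 - 2√u > 0`).
[cite: KemppainenSmirnov2017, §3.3 eq. (10) and Prop. 3.8 (proof)] -/
theorem IsGeneratedByCurve.exists_le_abs_re_incrCurve_sub_of_exists (s : ℝ≥0) {u : ℝ≥0} {l : ℝ}
    (hl : 1162 * Real.sqrt u < l) (h : ∃ r₀ ≤ u, l ≤ |W (s + r₀) - W s|) :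
    ∃ r ≤ u, l / 581 - 2 * Real.sqrt u ≤ |(incrCurve W γ s r).re - W s| := by
  obtain ⟨r₀, hr₀, hle⟩ := h
  have hsqrt : Real.sqrt r₀ ≤ Real.sqrt u := Real.sqrt_le_sqrt (by exact_mod_cast hr₀)
  have hL : 0 < l / 581 - 2 * Real.sqrt r₀ := by
    have : 1162 * Real.sqrt u / 581 < l / 581 := by gcongr
    linarith
  have hWu : 581 * (l / 581 - 2 * Real.sqrt r₀ + 2 * Real.sqrt r₀) ≤ |W (s + r₀) - W s| := by
    have : 581 * (l / 581 - 2 * Real.sqrt r₀ + 2 * Real.sqrt r₀) = l := by ring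
    rwa [this]
  obtain ⟨r, hr, hr'⟩ := hγ.exists_le_abs_re_incrCurve_sub hs hW s hL hWu
  exact ⟨r, hr.trans hr₀, le_trans (by linarith) hr'⟩

end Incr

end Loewner

/-! ### Tails of the driving increments from exit tails of the increment curves -/

section Tails

open Loewner

universe u

variable {Ω : Type*} [MeasurableSpace Ω]

/-- Arithmetic of the adjusted constants in the trivial regime `λ ≤ 1162 √u`: the adjusted bound
is at least `1`. [folklore] -/
private theorem one_le_adjusted {K c l v : ℝ} (hc : 0 ≤ c) (hv : 0 < v) (hl : l ≤ 1162 * v) :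
    (1 : ℝ) ≤ max K 1 * Real.exp (2 * c) * Real.exp (-(c / 581 * l / v)) := by
  have h1 : c / 581 * l / v ≤ 2 * c := by
    rw [div_le_iff₀ hv]
    have : c / 581 * l ≤ c / 581 * (1162 * v) := by gcongr
    linarith
  have h2 : (1 : ℝ) ≤ Real.exp (2 * c) * Real.exp (-(c / 581 * l / v)) := by
    rw [← Real.exp_add]
    exact Real.one_le_exp (by linarith)
  calc (1 : ℝ) ≤ 1 * (Real.exp (2 * c) * Real.exp (-(c / 581 * l / v))) := by linarith
    _ ≤ max K 1 * (Real.exp (2 * c) * Real.exp (-(c / 581 * l / v))) := by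
        gcongr
        exact le_max_right _ _
    _ = _ := by ring

/-- Monotonicity of a measure along an almost sure inclusion. [folklore] -/
private theorem measure_mono_of_ae_imp {P : Measure Ω} {A B : Set Ω} {p : Ω → Prop}
    (hp : ∀ᵐ ω ∂P, p ω) (h : ∀ ω, p ω → ω ∈ A → ω ∈ B) : P A ≤ P B :=
  measure_mono_ae (by filter_upwards [hp] with ω hω using h ω hω)

/-- **Kemppainen–Smirnov Prop. 3.8, the core step: a sub-exponential exit tail of the increment
curve gives a sub-exponential tail of the driving increment.** Let `(W, γ̂)` be a random Loewner
pair on a probability space — almost surely `γ̂(ω)` is a simple trace generating the chain of the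
continuous driving function `W(ω)`. Fix a time `s` and a duration `u > 0`, and suppose the
increment curve `β = gₛ(γ̂(s + ·))` leaves the strips around `W s` with sub-exponential tails,
`P{∃ r ≤ u, L ≤ |re β(r) - W s|} ≤ K exp(-c L/√u)` for all `L > 0` — the output of Prop. 3.7
(`KSRectangleExit.measure_reach_abs_re_le`) for the law of the recentred increment curve, which by
the height bound `im_incrCurve_le_two_mul_sqrt` stays in `{im ≤ 2√u}` up to capacity `u`. THEN
`P{∃ r ≤ u, λ ≤ |W (s + r) - W s|} ≤ max(K, 1) e^{2c} exp(-(c/581) λ/√u)` for all `λ > 0`: for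
`λ > 1162 √u` the event is contained in the exit event with `L = λ/581 - 2√u`
(`exists_le_abs_re_incrCurve_sub_of_exists`, KS's (10) for the increment chain), and
`K exp(-c L/√u) = K e^{2c} exp(-c λ/(581 √u))`; for `λ ≤ 1162 √u` the bound is `≥ 1`. (KS,
proof of Prop. 3.8: "by (10) and (11) [Prop. 3.7]".) [cite: KemppainenSmirnov2017, §3.3 eq. (10), Prop. 3.7 and Prop. 3.8 (proof)] -/
theorem measure_exists_le_abs_driving_sub_le_of_exitTail (P : Measure Ω) [IsProbabilityMeasure P]
    {W : Ω → ℝ≥0 → ℝ} {γ : Ω → ℝ≥0 → ℂ}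
    (hpair : ∀ᵐ ω ∂P, IsGeneratedByCurve (W ω) (γ ω) ∧ IsSimpleTrace (γ ω) ∧ Continuous (W ω))
    {s u : ℝ≥0} (hu : 0 < u) {K c : ℝ} (hc : 0 ≤ c)
    (hexit : ∀ L : ℝ, 0 < L →
      P {ω | ∃ r ≤ u, L ≤ |(incrCurve (W ω) (γ ω) s r).re - W ω s|} ≤
        ENNReal.ofReal (K * Real.exp (-(c * L / Real.sqrt u))))
    (l : ℝ) :
    P {ω | ∃ r ≤ u, l ≤ |W ω (s + r) - W ω s|} ≤
      ENNReal.ofReal (max K 1 * Real.exp (2 * c) * Real.exp (-(c / 581 * l / Real.sqrt u))) := by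
  have hsu : 0 < Real.sqrt u := Real.sqrt_pos.2 (by exact_mod_cast hu)
  rcases le_or_gt l (1162 * Real.sqrt u) with hsmall | hlarge
  · calc P {ω | ∃ r ≤ u, l ≤ |W ω (s + r) - W ω s|} ≤ P univ := measure_mono (subset_univ _)
      _ = 1 := measure_univ
      _ ≤ _ := by
          rw [← ENNReal.ofReal_one]
          exact ENNReal.ofReal_le_ofReal (one_le_adjusted hc hsu hsmall)
  · have hL : 0 < l / 581 - 2 * Real.sqrt u := by
      have : 1162 * Real.sqrt u / 581 < l / 581 := by gcongr
      linarith
    calc P {ω | ∃ r ≤ u, l ≤ |W ω (s + r) - W ω s|}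
        ≤ P {ω | ∃ r ≤ u, l / 581 - 2 * Real.sqrt u ≤
            |(incrCurve (W ω) (γ ω) s r).re - W ω s|} :=
          measure_mono_of_ae_imp hpair fun ω hω hmem ↦
            hω.1.exists_le_abs_re_incrCurve_sub_of_exists hω.2.1 hω.2.2 s hlarge hmem
      _ ≤ ENNReal.ofReal (K * Real.exp (-(c * (l / 581 - 2 * Real.sqrt u) / Real.sqrt u))) :=
          hexit _ hL
      _ ≤ _ := by
          refine ENNReal.ofReal_le_ofReal ?_
          have heq : -(c * (l / 581 - 2 * Real.sqrt u) / Real.sqrt u) =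
              2 * c + -(c / 581 * l / Real.sqrt u) := by
            field_simp
            ring
          rw [heq, Real.exp_add, ← mul_assoc]
          gcongr
          exact le_max_left _ _

/-- **The fixed-endpoint form**: under the same exit tail,
`P{λ ≤ |W (s + u) - W s|} ≤ max(K, 1) e^{2c} exp(-(c/581) λ/√u)`.
[cite: KemppainenSmirnov2017, §3.3 eq. (10), Prop. 3.7 and Prop. 3.8 (proof)] -/
theorem measure_le_abs_driving_sub_le_of_exitTail (P : Measure Ω) [IsProbabilityMeasure P]
    {W : Ω → ℝ≥0 → ℝ} {γ : Ω → ℝ≥0 → ℂ}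
    (hpair : ∀ᵐ ω ∂P, IsGeneratedByCurve (W ω) (γ ω) ∧ IsSimpleTrace (γ ω) ∧ Continuous (W ω))
    {s u : ℝ≥0} (hu : 0 < u) {K c : ℝ} (hc : 0 ≤ c)
    (hexit : ∀ L : ℝ, 0 < L →
      P {ω | ∃ r ≤ u, L ≤ |(incrCurve (W ω) (γ ω) s r).re - W ω s|} ≤
        ENNReal.ofReal (K * Real.exp (-(c * L / Real.sqrt u))))
    (l : ℝ) :
    P {ω | l ≤ |W ω (s + u) - W ω s|} ≤
      ENNReal.ofReal (max K 1 * Real.exp (2 * c) * Real.exp (-(c / 581 * l / Real.sqrt u))) := by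
  refine le_trans (measure_mono fun ω hω ↦ ?_)
    (measure_exists_le_abs_driving_sub_le_of_exitTail P hpair hu hc hexit l)
  exact ⟨u, le_rfl, hω⟩

/-- **Time zero: the tail of the running maximum of the driving function from the exit tail of
the curve itself** (`g₀ = id`, `incrCurve_time_zero`): if
`P{∃ r ≤ u, L ≤ |re γ̂(r) - W 0|} ≤ K exp(-c L/√u)` for all `L > 0` then
`P{∃ r ≤ u, λ ≤ |W r - W 0|} ≤ max(K, 1) e^{2c} exp(-(c/581) λ/√u)` — KS's
"`P(sup_{0 ≤ t ≤ n} |W_t| > b_n) ≤ K exp(-c b_n/(4√n))`" with the tree's constants.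
[cite: KemppainenSmirnov2017, Prop. 3.8 (1) (proof)] -/
theorem measure_exists_le_abs_driving_sub_zero_le_of_exitTail (P : Measure Ω)
    [IsProbabilityMeasure P] {W : Ω → ℝ≥0 → ℝ} {γ : Ω → ℝ≥0 → ℂ}
    (hpair : ∀ᵐ ω ∂P, IsGeneratedByCurve (W ω) (γ ω) ∧ IsSimpleTrace (γ ω) ∧ Continuous (W ω))
    {u : ℝ≥0} (hu : 0 < u) {K c : ℝ} (hc : 0 ≤ c)
    (hexit : ∀ L : ℝ, 0 < L →
      P {ω | ∃ r ≤ u, L ≤ |(γ ω r).re - W ω 0|} ≤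
        ENNReal.ofReal (K * Real.exp (-(c * L / Real.sqrt u))))
    (l : ℝ) :
    P {ω | ∃ r ≤ u, l ≤ |W ω r - W ω 0|} ≤
      ENNReal.ofReal (max K 1 * Real.exp (2 * c) * Real.exp (-(c / 581 * l / Real.sqrt u))) := by
  have hexit' : ∀ L : ℝ, 0 < L →
      P {ω | ∃ r ≤ u, L ≤ |(incrCurve (W ω) (γ ω) 0 r).re - W ω 0|} ≤
        ENNReal.ofReal (K * Real.exp (-(c * L / Real.sqrt u))) := fun L hL ↦
    le_trans (measure_mono_of_ae_imp hpair fun ω hω hmem ↦ by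
      simpa only [mem_setOf_eq, hω.1.incrCurve_time_zero hω.2.1 hω.2.2] using hmem) (hexit L hL)
  simpa only [zero_add] using
    measure_exists_le_abs_driving_sub_le_of_exitTail P hpair hu hc hexit' l

/-- **Two-time tails in the format of `Process/HolderNormTightness.lean`.** If on the horizon
`[0, T]` the increment curves have the exit tails `P{∃ r ≤ u, L ≤ |re β(r) - W s|} ≤
K exp(-c L/√u)` for all `s`, `0 < u ≤ 1` with `s + u ≤ T` and all `L > 0`, then
`P{λ ≤ |W s - W t|} ≤ max(K, 1) e^{2c} exp(-(c/581) λ/√(t - s))` for `s < t ≤ T`, `t - s ≤ 1`,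
`λ > 0` — the hypothesis of `Process.exists_holderConst_of_subexp_tails`,
`Process.exists_modulus_of_subexp_tails`, `Process.exists_scales_of_subexp_tails` (KS Prop. 3.8
(2), Thm. 3.9) for the driving process `X_t(ω) = W ω t`.
[cite: KemppainenSmirnov2017, Prop. 3.8 (proof)] -/
theorem subexp_tails_of_exitTails (P : Measure Ω) [IsProbabilityMeasure P]
    {W : Ω → ℝ≥0 → ℝ} {γ : Ω → ℝ≥0 → ℂ}
    (hpair : ∀ᵐ ω ∂P, IsGeneratedByCurve (W ω) (γ ω) ∧ IsSimpleTrace (γ ω) ∧ Continuous (W ω))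
    {T : ℕ} {K c : ℝ} (hc : 0 ≤ c)
    (hexit : ∀ s u : ℝ≥0, 0 < u → (s : ℝ) + u ≤ T → (u : ℝ) ≤ 1 → ∀ L : ℝ, 0 < L →
      P {ω | ∃ r ≤ u, L ≤ |(incrCurve (W ω) (γ ω) s r).re - W ω s|} ≤
        ENNReal.ofReal (K * Real.exp (-(c * L / Real.sqrt u)))) :
    ∀ s t : ℝ≥0, s < t → (t : ℝ) ≤ T → (t : ℝ) - s ≤ 1 → ∀ l : ℝ, 0 < l →
      P {ω | l ≤ dist (W ω s) (W ω t)} ≤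
        ENNReal.ofReal (max K 1 * Real.exp (2 * c) *
          Real.exp (-(c / 581 * l / Real.sqrt ((t : ℝ) - s)))) := by
  intro s t hst htT hts l _
  set u : ℝ≥0 := t - s with hu
  have hu0 : 0 < u := tsub_pos_of_lt hst
  have hsu : s + u = t := add_tsub_cancel_of_le hst.le
  have hucoe : (u : ℝ) = t - s := NNReal.coe_sub hst.le
  have h1 : (s : ℝ) + u ≤ T := by rw [hucoe]; linarith
  have h2 : (u : ℝ) ≤ 1 := by rw [hucoe]; exact hts
  have h := measure_le_abs_driving_sub_le_of_exitTail P hpair hu0 hc (hexit s u hu0 h1 h2) l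
  rw [hucoe, hsu] at h
  refine le_trans (measure_mono fun ω hω ↦ ?_) h
  rwa [mem_setOf_eq, Real.dist_eq, abs_sub_comm] at hω

/-- **Kemppainen–Smirnov Prop. 3.8 (1): the bounds `b_M` on the running maximum of the driving
function, uniformly in the pair.** Given horizon constants `K M`, `c M > 0` and `ε > 0` there are
levels `b M > 0` such that for EVERY random Loewner pair `(W, γ̂)` (on any probability space)
whose curve has the time-zero exit tails `P{∃ r ≤ M + 1, L ≤ |re γ̂(r) - W 0|} ≤
K_M exp(-c_M L/√(M + 1))` (`L > 0`, all `M`; the increment curve at time `0` is `γ̂` itself,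
`Loewner.IsGeneratedByCurve.incrCurve_time_zero`), the event "`|W r - W 0| > b M` for some `M`
and some `r ≤ M + 1`" has probability `≤ ε` (choose `b M` with
`max(K_M, 1) e^{2 c_M} exp(-(c_M/581) b M/√(M+1)) ≤ ε 2^{-(M+1)}` and sum over `M`). With
`W 0 = 0` this is KS's event `E₁` of §3.5 ("`P(sup_{0 ≤ t ≤ n} |W_t| ≤ b_n) ≥ 1 - 1/n`",
here at level `ε 2^{-(n+1)}` for all `n` at once), whose consequence for the capacity of the curve
is `MarkedDomain.IsChordalUniformizing.exists_capRad_of_driving_bound`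
(`LoewnerRegularCurves.lean`, the clause `IsRegularCurve.le_capacity`).
[cite: KemppainenSmirnov2017, Prop. 3.8 (1) and §3.5] -/
theorem exists_drivingBound_of_exitTails (K c : ℕ → ℝ) (hc : ∀ M, 0 < c M) {ε : ℝ≥0∞}
    (hε : 0 < ε) :
    ∃ b : ℕ → ℝ, (∀ M, 0 < b M) ∧
      ∀ {Ω : Type u} {mΩ : MeasurableSpace Ω} (P : Measure Ω) [IsProbabilityMeasure P]
        (W : Ω → ℝ≥0 → ℝ) (γ : Ω → ℝ≥0 → ℂ),
        (∀ᵐ ω ∂P, IsGeneratedByCurve (W ω) (γ ω) ∧ IsSimpleTrace (γ ω) ∧ Continuous (W ω)) →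
        (∀ (M : ℕ) (L : ℝ), 0 < L →
          P {ω | ∃ r ≤ (M : ℝ≥0) + 1, L ≤ |(incrCurve (W ω) (γ ω) 0 r).re - W ω 0|} ≤
            ENNReal.ofReal (K M * Real.exp (-(c M * L / Real.sqrt ((M : ℝ) + 1))))) →
        P {ω | ∃ (M : ℕ) (r : ℝ≥0), r ≤ (M : ℝ≥0) + 1 ∧ b M < |W ω r - W ω 0|} ≤ ε := by
  -- levels `ε_M = ε 2^{-(M+1)}`
  have hεM : ∀ M : ℕ, 0 < ε * (2 : ℝ≥0∞)⁻¹ ^ (M + 1) := fun M ↦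
    ENNReal.mul_pos hε.ne' (ENNReal.pow_pos (by norm_num) _).ne'
  -- choice of `b M`: the adjusted tail bound at `b M` is below `ε_M`
  have hb : ∀ M : ℕ, ∃ b : ℝ, 0 < b ∧
      ENNReal.ofReal (max (K M) 1 * Real.exp (2 * c M) *
        Real.exp (-(c M / 581 * b / Real.sqrt ((M : ℝ) + 1)))) < ε * 2⁻¹ ^ (M + 1) := by
    intro M
    have ha : 0 < c M / 581 / Real.sqrt ((M : ℝ) + 1) := by
      have := hc M
      positivity
    have hlim : Tendsto (fun b : ℝ ↦ ENNReal.ofReal (max (K M) 1 * Real.exp (2 * c M) *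
        Real.exp (-(c M / 581 * b / Real.sqrt ((M : ℝ) + 1))))) atTop (𝓝 0) := by
      rw [← ENNReal.ofReal_zero]
      refine ENNReal.tendsto_ofReal ?_
      rw [← mul_zero (max (K M) 1 * Real.exp (2 * c M))]
      refine Tendsto.const_mul _ (Real.tendsto_exp_atBot.comp ?_)
      have h1 : Tendsto (fun b : ℝ ↦ c M / 581 / Real.sqrt ((M : ℝ) + 1) * b) atTop atTop :=
        tendsto_id.const_mul_atTop ha
      refine (tendsto_neg_atTop_atBot.comp h1).congr fun b ↦ ?_
      simp only [Function.comp_apply]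
      ring
    obtain ⟨b, hb1, hb2⟩ :=
      ((hlim.eventually_lt_const (hεM M)).and (eventually_gt_atTop 0)).exists
    exact ⟨b, hb2, hb1⟩
  choose b hb0 hb using hb
  refine ⟨b, hb0, fun P _ W γ hpair hexit ↦ ?_⟩
  have hcast : ∀ M : ℕ, (((M : ℝ≥0) + 1 : ℝ≥0) : ℝ) = (M : ℝ) + 1 := fun M ↦ by push_cast; ring
  calc P {ω | ∃ (M : ℕ) (r : ℝ≥0), r ≤ (M : ℝ≥0) + 1 ∧ b M < |W ω r - W ω 0|}
      ≤ P (⋃ M : ℕ, {ω | ∃ r ≤ (M : ℝ≥0) + 1, b M ≤ |W ω r - W ω 0|}) := by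
        refine measure_mono fun ω hω ↦ ?_
        obtain ⟨M, r, hr, hlt⟩ := hω
        exact mem_iUnion.2 ⟨M, r, hr, hlt.le⟩
    _ ≤ ∑' M : ℕ, P {ω | ∃ r ≤ (M : ℝ≥0) + 1, b M ≤ |W ω r - W ω 0|} := measure_iUnion_le _
    _ ≤ ∑' M : ℕ, ε * 2⁻¹ ^ (M + 1) := by
        refine ENNReal.tsum_le_tsum fun M ↦ ?_
        have hu : (0 : ℝ≥0) < (M : ℝ≥0) + 1 := by positivity
        have hexit' : ∀ L : ℝ, 0 < L →
            P {ω | ∃ r ≤ (M : ℝ≥0) + 1, L ≤ |(incrCurve (W ω) (γ ω) 0 r).re - W ω 0|} ≤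
              ENNReal.ofReal (K M * Real.exp
                (-(c M * L / Real.sqrt (((M : ℝ≥0) + 1 : ℝ≥0) : ℝ)))) :=
          fun L hL ↦ by rw [hcast]; exact hexit M L hL
        have h := measure_exists_le_abs_driving_sub_le_of_exitTail P hpair hu (hc M).le hexit' (b M)
        simp only [zero_add] at h
        rw [hcast] at h
        exact h.trans (hb M).le
    _ = ε := by
        simp_rw [pow_succ, ← mul_assoc]
        rw [ENNReal.tsum_mul_right, ENNReal.tsum_mul_left, ENNReal.tsum_geometric,
          ENNReal.one_sub_inv_two, inv_inv, mul_assoc,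
          ENNReal.mul_inv_cancel (by norm_num) (by norm_num), mul_one]

/-- **Kemppainen–Smirnov Thm. 3.9: the Hölder norm of the driving process is stochastically
bounded, uniformly in the pair.** For `0 < α < 1/2`, constants `K`, `c > 0`, a horizon `T` and
`ε > 0` there is ONE constant `C` such that for every random Loewner pair with the exit tails of
`subexp_tails_of_exitTails` on `[0, T]` the driving function is `α`-Hölder on `[0, T]` with
constant `C` outside an event of probability `≤ ε` (`Process.exists_holderConst_of_subexp_tails`).
[cite: KemppainenSmirnov2017, Prop. 3.8 (2) and Thm. 3.9] -/
theorem exists_holderConst_driving_of_exitTails {α : ℝ≥0} (hα0 : 0 < α) (hα : (α : ℝ) < 1 / 2)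
    (K : ℝ) {c : ℝ} (hc : 0 < c) (T : ℕ) {ε : ℝ≥0∞} (hε : 0 < ε) :
    ∃ C : ℝ≥0, ∀ {Ω : Type u} {mΩ : MeasurableSpace Ω} (P : Measure Ω) [IsProbabilityMeasure P]
        (W : Ω → ℝ≥0 → ℝ) (γ : Ω → ℝ≥0 → ℂ),
        (∀ᵐ ω ∂P, IsGeneratedByCurve (W ω) (γ ω) ∧ IsSimpleTrace (γ ω) ∧ Continuous (W ω)) →
        (∀ s u : ℝ≥0, 0 < u → (s : ℝ) + u ≤ T → (u : ℝ) ≤ 1 → ∀ L : ℝ, 0 < L →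
          P {ω | ∃ r ≤ u, L ≤ |(incrCurve (W ω) (γ ω) s r).re - W ω s|} ≤
            ENNReal.ofReal (K * Real.exp (-(c * L / Real.sqrt u)))) →
        P {ω | ¬ HolderOnWith C α (W ω) (Icc 0 T)} ≤ ε := by
  have hc' : 0 < c / 581 := by positivity
  obtain ⟨C, hC⟩ := Process.exists_holderConst_of_subexp_tails (E := ℝ) hα0 hα
    (max K 1 * Real.exp (2 * c)) hc' T hε
  refine ⟨C, fun P _ W γ hpair hexit ↦ ?_⟩
  have hcont : ∀ᵐ ω ∂P, Continuous fun t ↦ W ω t := by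
    filter_upwards [hpair] with ω hω using hω.2.2
  exact hC P (fun t ω ↦ W ω t) hcont (subexp_tails_of_exitTails P hpair hc.le hexit)

/-- **Kemppainen–Smirnov's event `E₃` (§3.5): one driving modulus for all horizons, uniformly in
the pair.** Given horizon constants `K T`, `c T > 0` and `ε > 0` there are moduli `μ T → 0` at
`0⁺` such that for every random Loewner pair whose increment curves have the exit tails
`P{∃ r ≤ u, L ≤ |re β(r) - W s|} ≤ K_T exp(-c_T L/√u)` (`0 < u ≤ 1`, `s + u ≤ T`, `L > 0`, all
`T`), outside ONE event of probability `≤ ε` the driving function satisfies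
`|W s - W t| ≤ μ T (|s - t|)` for all `T` and `s, t ≤ T` — the clause
`IsRegularCurve.driving_modulus` of `LoewnerRegularCurves.lean` with the moduli
`LoewnerRegularity.drvMod := μ` (`Process.exists_modulus_of_subexp_tails` with `α = 1/4`).
[cite: KemppainenSmirnov2017, Prop. 3.8, Thm. 3.9 and §3.5] -/
theorem exists_drivingModulus_of_exitTails (K c : ℕ → ℝ) (hc : ∀ T, 0 < c T) {ε : ℝ≥0∞}
    (hε : 0 < ε) :
    ∃ μ : ℕ → ℝ → ℝ, (∀ T, Tendsto (μ T) (𝓝[>] 0) (𝓝 0)) ∧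
      ∀ {Ω : Type u} {mΩ : MeasurableSpace Ω} (P : Measure Ω) [IsProbabilityMeasure P]
        (W : Ω → ℝ≥0 → ℝ) (γ : Ω → ℝ≥0 → ℂ),
        (∀ᵐ ω ∂P, IsGeneratedByCurve (W ω) (γ ω) ∧ IsSimpleTrace (γ ω) ∧ Continuous (W ω)) →
        (∀ (T : ℕ) (s u : ℝ≥0), 0 < u → (s : ℝ) + u ≤ T → (u : ℝ) ≤ 1 → ∀ L : ℝ, 0 < L →
          P {ω | ∃ r ≤ u, L ≤ |(incrCurve (W ω) (γ ω) s r).re - W ω s|} ≤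
            ENNReal.ofReal (K T * Real.exp (-(c T * L / Real.sqrt u)))) →
        P {ω | ∃ (T : ℕ) (s t : ℝ≥0), (s : ℝ) ≤ T ∧ (t : ℝ) ≤ T ∧
          μ T (dist s t) < dist (W ω s) (W ω t)} ≤ ε := by
  have hα0 : (0 : ℝ≥0) < 1 / 4 := by norm_num
  have hα : ((1 / 4 : ℝ≥0) : ℝ) < 1 / 2 := by norm_num
  obtain ⟨μ, hμ, h⟩ := Process.exists_modulus_of_subexp_tails (E := ℝ) hα0 hα
    (fun T ↦ max (K T) 1 * Real.exp (2 * c T)) (fun T ↦ c T / 581)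
    (fun T ↦ by have := hc T; positivity) hε
  refine ⟨μ, hμ, fun P _ W γ hpair hexit ↦ ?_⟩
  have hcont : ∀ᵐ ω ∂P, Continuous fun t ↦ W ω t := by
    filter_upwards [hpair] with ω hω using hω.2.2
  exact h P (fun t ω ↦ W ω t) hcont fun T ↦ subexp_tails_of_exitTails P hpair (hc T).le (hexit T)

/-- **Box form: the scales `δW` of the Kemppainen–Smirnov boxes, uniformly in the pair.** Given
horizon constants `K T`, `c T > 0` and `ε > 0` there are scales `δW k > 0` such that for every
random Loewner pair with the exit tails of `exists_drivingModulus_of_exitTails`, outside ONE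
event of probability `≤ ε` the driving function has the box moduli "`s, t ≤ k + 1`,
`|s - t| ≤ δW k` ⟹ `|W s - W t| ≤ 1/(k+1)`" for all `k` — membership of `W` in
`Process.modulusSet {W 0} δW`, the driving half of the compact boxes of Loewner pairs of
`LoewnerRegularBoxes.lean` / `DrivingProcessWeakLimitVarying.lean`
(`Process.exists_scales_of_subexp_tails` with `α = 1/4`).
[cite: KemppainenSmirnov2017, Prop. 3.8, Thm. 3.9 and §3.5] -/
theorem exists_drivingScales_of_exitTails (K c : ℕ → ℝ) (hc : ∀ T, 0 < c T) {ε : ℝ≥0∞}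
    (hε : 0 < ε) :
    ∃ δW : ℕ → ℝ, (∀ k, 0 < δW k) ∧
      ∀ {Ω : Type u} {mΩ : MeasurableSpace Ω} (P : Measure Ω) [IsProbabilityMeasure P]
        (W : Ω → ℝ≥0 → ℝ) (γ : Ω → ℝ≥0 → ℂ),
        (∀ᵐ ω ∂P, IsGeneratedByCurve (W ω) (γ ω) ∧ IsSimpleTrace (γ ω) ∧ Continuous (W ω)) →
        (∀ (T : ℕ) (s u : ℝ≥0), 0 < u → (s : ℝ) + u ≤ T → (u : ℝ) ≤ 1 → ∀ L : ℝ, 0 < L →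
          P {ω | ∃ r ≤ u, L ≤ |(incrCurve (W ω) (γ ω) s r).re - W ω s|} ≤
            ENNReal.ofReal (K T * Real.exp (-(c T * L / Real.sqrt u)))) →
        P {ω | ∃ (k : ℕ) (s t : ℝ≥0), (s : ℝ) ≤ k + 1 ∧ (t : ℝ) ≤ k + 1 ∧ dist s t ≤ δW k ∧
          1 / ((k : ℝ) + 1) < dist (W ω s) (W ω t)} ≤ ε := by
  have hα0 : (0 : ℝ≥0) < 1 / 4 := by norm_num
  have hα : ((1 / 4 : ℝ≥0) : ℝ) < 1 / 2 := by norm_num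
  obtain ⟨δW, hδW, h⟩ := Process.exists_scales_of_subexp_tails (E := ℝ) hα0 hα
    (fun T ↦ max (K T) 1 * Real.exp (2 * c T)) (fun T ↦ c T / 581)
    (fun T ↦ by have := hc T; positivity) hε
  refine ⟨δW, hδW, fun P _ W γ hpair hexit ↦ ?_⟩
  have hcont : ∀ᵐ ω ∂P, Continuous fun t ↦ W ω t := by
    filter_upwards [hpair] with ω hω using hω.2.2
  exact h P (fun t ω ↦ W ω t) hcont fun T ↦ subexp_tails_of_exitTails P hpair (hc T).le (hexit T)

end Tails

/-! ### Exit tails from Kemppainen–Smirnov's rectangle-exit bound (Prop. 3.7) -/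

section Bridge

open Loewner

variable {Ω : Type*} [MeasurableSpace Ω]

/-- Arithmetic of the rectangle-exit bound: `2 · 2^{-n} ≤ 4 exp(-(log 2/(2C)) L/v)` once
`L/(2Cv) - 1 ≤ n`. [folklore] -/
private theorem two_mul_inv_two_pow_le {C L v : ℝ} (hC : 0 < C) (hv : 0 < v) {n : ℕ}
    (hn : L / (C * (2 * v)) - 1 ≤ n) :
    (2 : ℝ≥0∞) * 2⁻¹ ^ n ≤ ENNReal.ofReal (4 * Real.exp (-(Real.log 2 / (2 * C) * L / v))) := by
  have h2 : (2 : ℝ≥0∞) * 2⁻¹ ^ n = ENNReal.ofReal (2 * (2 : ℝ) ^ (-(n : ℝ))) := by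
    rw [ENNReal.ofReal_mul zero_le_two, ENNReal.ofReal_ofNat, Real.rpow_neg zero_le_two,
      Real.rpow_natCast, ENNReal.ofReal_inv_of_pos (by positivity), ENNReal.ofReal_pow zero_le_two,
      ENNReal.ofReal_ofNat, ENNReal.inv_pow]
  rw [h2]
  refine ENNReal.ofReal_le_ofReal ?_
  set x : ℝ := L / (C * (2 * v)) with hxdef
  have hx : Real.exp (-(Real.log 2 / (2 * C) * L / v)) = (2 : ℝ) ^ (-x) := by
    rw [Real.rpow_def_of_pos two_pos]
    congr 1
    rw [hxdef]
    field_simp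
  rw [hx]
  have h1 : (2 : ℝ) ^ (-(n : ℝ)) ≤ 2 ^ (1 - x) :=
    Real.rpow_le_rpow_of_exponent_le one_le_two (by linarith)
  have h3 : (2 : ℝ) ^ (1 - x) = 2 * 2 ^ (-x) := by
    rw [sub_eq_add_neg, Real.rpow_add two_pos, Real.rpow_one]
  calc 2 * (2 : ℝ) ^ (-(n : ℝ)) ≤ 2 * 2 ^ (1 - x) := by linarith
    _ = 4 * 2 ^ (-x) := by rw [h3]; ring

/-- **Kemppainen–Smirnov's Prop. 3.7 feeds Prop. 3.8: the exit tail of the increment curve from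
the boundary-annulus crossing bound for its law.** Let `(W, γ̂)` be a random Loewner pair (a.s.
simple trace, generated chain, continuous driving function) on a probability space, `s` a time,
`u > 0` a duration, and `crv ω` ANY measurable choice of curve classes representing the recentred
increment curves on `[0, u]` — a.s. `(crv ω).source = 0` and
`(crv ω).range = (β - W s)([0, u])`, `β = gₛ(γ̂(s + ·))`. If the law `P ∘ crv⁻¹` satisfies the
instances of Condition G2 in `ℍ` used by Prop. 3.7 (hypothesis `hG` of
`KSRectangleExit.measure_reach_abs_re_le`, with the inner radius `2√u` — the height of the
increment curve up to capacity `u`, `im_incrCurve_le_two_mul_sqrt` — and constant `C > 1`), then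
`P{∃ r ≤ u, L ≤ |re β(r) - W s|} ≤ 4 exp(-(log 2/(2C)) L/√u)` for every `L > 0`: on this event the
class `crv ω` starts at `0`, reaches `{|re| ≥ L}`, and its initial segment stays in the strip
`{|im| ≤ 2√u}` (the whole trace does), so with `n = ⌈L/(2C√u)⌉ - 1` lines and threshold
`x₀ = L - 2nC√u > 0` it lies in the event of `measure_reach_abs_re_le`, of probability
`≤ 2 · 2^{-n} ≤ 4 · 2^{-L/(2C√u)}`. This is the hypothesis `hexit` of
`measure_exists_le_abs_driving_sub_le_of_exitTail` with `K = 4`, `c = log 2/(2C)`.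
[cite: KemppainenSmirnov2017, §3.3, Prop. 3.7 and Prop. 3.8 (proof)] -/
theorem exitTail_of_rectangleExit (P : Measure Ω) [IsProbabilityMeasure P]
    {W : Ω → ℝ≥0 → ℝ} {γ : Ω → ℝ≥0 → ℂ}
    (hpair : ∀ᵐ ω ∂P, IsGeneratedByCurve (W ω) (γ ω) ∧ IsSimpleTrace (γ ω) ∧ Continuous (W ω))
    {s u : ℝ≥0} (hu : 0 < u) {C : ℝ} (hC : 1 < C)
    (crv : Ω → CurveClass ℂ) (hcrv : AEMeasurable crv P)
    (hrep : ∀ᵐ ω ∂P, (crv ω).source = 0 ∧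
      (crv ω).range = (fun r ↦ incrCurve (W ω) (γ ω) s r - W ω s) '' Icc 0 u)
    (hG : ∀ F : Set ℂ, IsClosed F → F.Nonempty → ∀ (z₀ : ℝ) (S : Set (CurveClass ℂ)),
      MeasurableSet S →
      S ⊆ {p | Disjoint p.range (ball ((z₀ : ℝ) : ℂ) (C * (2 * Real.sqrt u)))} →
      P.map crv (CurveClass.stopAt F ⁻¹' S ∩
          {c | c.startFrom F ∈ CurveClass.crossingIn ((z₀ : ℝ) : ℂ) (2 * Real.sqrt u)
            (C * (2 * Real.sqrt u)) univ}) ≤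
        2⁻¹ * P.map crv (CurveClass.stopAt F ⁻¹' S))
    (L : ℝ) (hL : 0 < L) :
    P {ω | ∃ r ≤ u, L ≤ |(incrCurve (W ω) (γ ω) s r).re - W ω s|} ≤
      ENNReal.ofReal (4 * Real.exp (-(Real.log 2 / (2 * C) * L / Real.sqrt u))) := by
  have hsu : 0 < Real.sqrt u := Real.sqrt_pos.2 (by exact_mod_cast hu)
  have hC0 : 0 < C := zero_lt_one.trans hC
  set u' : ℝ := 2 * Real.sqrt u with hu'def
  have hu' : 0 < u' := by positivity
  have hCu' : 0 < C * u' := mul_pos hC0 hu'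
  -- the number of lines and the threshold
  set x : ℝ := L / (C * u') with hxdef
  have hx : 0 < x := div_pos hL hCu'
  set N : ℕ := ⌈x⌉₊ with hNdef
  have hN : 1 ≤ N := Nat.one_le_iff_ne_zero.2 (Nat.ceil_pos.2 hx).ne'
  set n : ℕ := N - 1 with hndef
  have hn_real : (n : ℝ) = N - 1 := by rw [hndef, Nat.cast_sub hN, Nat.cast_one]
  have hn_lt : (n : ℝ) < x := by
    rw [hn_real]
    have := Nat.ceil_lt_add_one hx.le
    linarith
  have hn_ge : x - 1 ≤ n := by
    rw [hn_real]
    have := Nat.le_ceil x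
    linarith
  set x₀ : ℝ := L - n * (C * u') with hx₀def
  have hx₀ : 0 < x₀ := by
    have h1 : (n : ℝ) * (C * u') < x * (C * u') := mul_lt_mul_of_pos_right hn_lt hCu'
    have hxL : x * (C * u') = L := div_mul_cancel₀ L hCu'.ne'
    rw [hx₀def]
    linarith
  have hL_eq : x₀ + n * (C * u') = L := by rw [hx₀def]; ring
  -- Kemppainen–Smirnov's rectangle event and its bound
  set H : Set ℂ := {z : ℂ | x₀ + n * (C * u') ≤ |z.re|} with hHdef
  set E : Set (CurveClass ℂ) := {c | |c.source.re| < x₀ ∧ (c.range ∩ H).Nonempty ∧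
    (c.stopAt H).range ⊆ {z : ℂ | |z.im| ≤ u'}} with hEdef
  have hKS : P.map crv E ≤ 2 * 2⁻¹ ^ n * P.map crv univ :=
    measure_reach_abs_re_le (P.map crv) hC hu' hG x₀ n
  -- the exit event is carried into `E` by `crv`
  have hincl : P {ω | ∃ r ≤ u, L ≤ |(incrCurve (W ω) (γ ω) s r).re - W ω s|} ≤
      P (crv ⁻¹' E) := by
    refine measure_mono_of_ae_imp (hpair.and hrep) fun ω hω hmem ↦ ?_
    obtain ⟨⟨hgen, hsim, hWc⟩, hsrc, hrange⟩ := hω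
    obtain ⟨r, hr, hLr⟩ := hmem
    have hβ := hgen.incr_sub hsim hWc s
    refine ⟨?_, ?_, ?_⟩
    · rw [hsrc]
      simpa using hx₀
    · refine ⟨incrCurve (W ω) (γ ω) s r - W ω s, ?_, ?_⟩
      · rw [hrange]
        exact ⟨r, ⟨bot_le, hr⟩, rfl⟩
      · show x₀ + n * (C * u') ≤ |(incrCurve (W ω) (γ ω) s r - ((W ω s : ℝ) : ℂ)).re|
        rw [hL_eq]
        simpa using hLr
    · intro z hz
      have hz' := CurveClass.range_stopAt_subset H (crv ω) hz
      rw [hrange] at hz'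
      obtain ⟨r', hr', rfl⟩ := hz'
      show |(incrCurve (W ω) (γ ω) s r' - ((W ω s : ℝ) : ℂ)).im| ≤ u'
      have him0 : 0 ≤ (incrCurve (W ω) (γ ω) s r' - ((W ω s : ℝ) : ℂ)).im := hβ.2.2.1 r'
      rw [abs_of_nonneg him0]
      simpa using hgen.im_incrCurve_le_two_mul_sqrt hsim hWc s hr'.2
  calc P {ω | ∃ r ≤ u, L ≤ |(incrCurve (W ω) (γ ω) s r).re - W ω s|}
      ≤ P (crv ⁻¹' E) := hincl
    _ ≤ P.map crv E := Measure.le_map_apply hcrv E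
    _ ≤ 2 * 2⁻¹ ^ n * P.map crv univ := hKS
    _ = 2 * 2⁻¹ ^ n := by
        rw [Measure.map_apply_of_aemeasurable hcrv MeasurableSet.univ, preimage_univ, measure_univ,
          mul_one]
    _ ≤ ENNReal.ofReal (4 * Real.exp (-(Real.log 2 / (2 * C) * L / Real.sqrt u))) :=
        two_mul_inv_two_pow_le hC0 hsu (by rw [← hu'def]; exact hn_ge)

/-! ### The events `E₁`, `E₃` of Kemppainen–Smirnov's §3.5 from the rectangle-exit bounds -/

universe u

/-- **Kemppainen–Smirnov's `E₁` from Condition G2 in `ℍ` (Prop. 3.7 ⟹ Prop. 3.8 (1)).** For a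
constant `C > 1` and `ε > 0` there are levels `b M > 0` such that for every random Loewner pair
`(W, γ̂)` on a probability space for which, at every horizon `M + 1`, some measurable choice of
classes `crv ω` of the recentred curves `γ̂ - W 0` on `[0, M + 1]` has a law satisfying the
boundary-annulus crossing bound of `KSRectangleExit.measure_reach_abs_re_le` (inner radius
`2√(M+1)`, constant `C`), the running maxima obey `|W r - W 0| ≤ b M` for all `M` and
`r ≤ M + 1` outside ONE event of probability `≤ ε` (`exitTail_of_rectangleExit` at time `0`,
`incrCurve_time_zero`, and `exists_drivingBound_of_exitTails` with `K = 4`, `c = log 2/(2C)`).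
[cite: KemppainenSmirnov2017, Prop. 3.7, Prop. 3.8 (1) and §3.5] -/
theorem exists_drivingBound_of_rectangleExit {C : ℝ} (hC : 1 < C) {ε : ℝ≥0∞} (hε : 0 < ε) :
    ∃ b : ℕ → ℝ, (∀ M, 0 < b M) ∧
      ∀ {Ω : Type u} {mΩ : MeasurableSpace Ω} (P : Measure Ω) [IsProbabilityMeasure P]
        (W : Ω → ℝ≥0 → ℝ) (γ : Ω → ℝ≥0 → ℂ),
        (∀ᵐ ω ∂P, IsGeneratedByCurve (W ω) (γ ω) ∧ IsSimpleTrace (γ ω) ∧ Continuous (W ω)) →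
        (∀ M : ℕ, ∃ crv : Ω → CurveClass ℂ, AEMeasurable crv P ∧
          (∀ᵐ ω ∂P, (crv ω).source = 0 ∧
            (crv ω).range = (fun r ↦ γ ω r - W ω 0) '' Icc 0 ((M : ℝ≥0) + 1)) ∧
          ∀ F : Set ℂ, IsClosed F → F.Nonempty → ∀ (z₀ : ℝ) (S : Set (CurveClass ℂ)),
            MeasurableSet S →
            S ⊆ {p | Disjoint p.range
              (ball ((z₀ : ℝ) : ℂ) (C * (2 * Real.sqrt ((M : ℝ) + 1))))} →
            P.map crv (CurveClass.stopAt F ⁻¹' S ∩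
                {c | c.startFrom F ∈ CurveClass.crossingIn ((z₀ : ℝ) : ℂ)
                  (2 * Real.sqrt ((M : ℝ) + 1)) (C * (2 * Real.sqrt ((M : ℝ) + 1))) univ}) ≤
              2⁻¹ * P.map crv (CurveClass.stopAt F ⁻¹' S)) →
        P {ω | ∃ (M : ℕ) (r : ℝ≥0), r ≤ (M : ℝ≥0) + 1 ∧ b M < |W ω r - W ω 0|} ≤ ε := by
  have hc : 0 < Real.log 2 / (2 * C) := by
    have := Real.log_pos one_lt_two
    positivity
  obtain ⟨b, hb0, h⟩ := exists_drivingBound_of_exitTails (fun _ ↦ (4 : ℝ))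
    (fun _ ↦ Real.log 2 / (2 * C)) (fun _ ↦ hc) hε
  refine ⟨b, hb0, fun P _ W γ hpair hrect ↦ h P W γ hpair fun M L hL ↦ ?_⟩
  obtain ⟨crv, hcrv, hrep, hG⟩ := hrect M
  have hcast : (((M : ℝ≥0) + 1 : ℝ≥0) : ℝ) = (M : ℝ) + 1 := by push_cast; ring
  have hu : (0 : ℝ≥0) < (M : ℝ≥0) + 1 := by positivity
  -- the representation hypothesis in terms of the increment curve at time `0`
  have hrep' : ∀ᵐ ω ∂P, (crv ω).source = 0 ∧
      (crv ω).range = (fun r ↦ incrCurve (W ω) (γ ω) 0 r - W ω 0) '' Icc 0 ((M : ℝ≥0) + 1) := by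
    filter_upwards [hpair, hrep] with ω hω hω'
    rw [hω.1.incrCurve_time_zero hω.2.1 hω.2.2]
    exact hω'
  -- the crossing bound with the radius written through the `ℝ≥0` horizon
  have hG' : ∀ F : Set ℂ, IsClosed F → F.Nonempty → ∀ (z₀ : ℝ) (S : Set (CurveClass ℂ)),
      MeasurableSet S →
      S ⊆ {p | Disjoint p.range
        (ball ((z₀ : ℝ) : ℂ) (C * (2 * Real.sqrt (((M : ℝ≥0) + 1 : ℝ≥0) : ℝ))))} →
      P.map crv (CurveClass.stopAt F ⁻¹' S ∩
          {c | c.startFrom F ∈ CurveClass.crossingIn ((z₀ : ℝ) : ℂ)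
            (2 * Real.sqrt (((M : ℝ≥0) + 1 : ℝ≥0) : ℝ))
            (C * (2 * Real.sqrt (((M : ℝ≥0) + 1 : ℝ≥0) : ℝ))) univ}) ≤
        2⁻¹ * P.map crv (CurveClass.stopAt F ⁻¹' S) := by
    rw [hcast]
    exact hG
  have h := exitTail_of_rectangleExit P hpair hu hC crv hcrv hrep' hG' L hL
  rw [hcast] at h
  exact h

/-- **Kemppainen–Smirnov's `E₃` (one driving modulus for all horizons) from Condition G2 in `ℍ`
(Prop. 3.7 ⟹ Prop. 3.8 ⟹ Thm. 3.9 ⟹ §3.5).** For `C > 1` and `ε > 0` there are moduli `μ T → 0`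
at `0⁺` such that for every random Loewner pair `(W, γ̂)` on a probability space for which, for
all times `s` and durations `0 < u ≤ 1`, some measurable choice of classes of the recentred
increment curves `gₛ(γ̂(s + ·)) - W s` on `[0, u]` has a law satisfying the boundary-annulus
crossing bound of `KSRectangleExit.measure_reach_abs_re_le` (inner radius `2√u`, constant `C`),
outside ONE event of probability `≤ ε` the driving function satisfies
`|W s - W t| ≤ μ T (|s - t|)` for all `T` and `s, t ≤ T` — the clause
`IsRegularCurve.driving_modulus` (`LoewnerRegularCurves.lean`).
[cite: KemppainenSmirnov2017, Prop. 3.7, Prop. 3.8, Thm. 3.9 and §3.5] -/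
theorem exists_drivingModulus_of_rectangleExit {C : ℝ} (hC : 1 < C) {ε : ℝ≥0∞} (hε : 0 < ε) :
    ∃ μ : ℕ → ℝ → ℝ, (∀ T, Tendsto (μ T) (𝓝[>] 0) (𝓝 0)) ∧
      ∀ {Ω : Type u} {mΩ : MeasurableSpace Ω} (P : Measure Ω) [IsProbabilityMeasure P]
        (W : Ω → ℝ≥0 → ℝ) (γ : Ω → ℝ≥0 → ℂ),
        (∀ᵐ ω ∂P, IsGeneratedByCurve (W ω) (γ ω) ∧ IsSimpleTrace (γ ω) ∧ Continuous (W ω)) →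
        (∀ s u : ℝ≥0, 0 < u → (u : ℝ) ≤ 1 → ∃ crv : Ω → CurveClass ℂ, AEMeasurable crv P ∧
          (∀ᵐ ω ∂P, (crv ω).source = 0 ∧
            (crv ω).range = (fun r ↦ incrCurve (W ω) (γ ω) s r - W ω s) '' Icc 0 u) ∧
          ∀ F : Set ℂ, IsClosed F → F.Nonempty → ∀ (z₀ : ℝ) (S : Set (CurveClass ℂ)),
            MeasurableSet S →
            S ⊆ {p | Disjoint p.range (ball ((z₀ : ℝ) : ℂ) (C * (2 * Real.sqrt u)))} →
            P.map crv (CurveClass.stopAt F ⁻¹' S ∩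
                {c | c.startFrom F ∈ CurveClass.crossingIn ((z₀ : ℝ) : ℂ) (2 * Real.sqrt u)
                  (C * (2 * Real.sqrt u)) univ}) ≤
              2⁻¹ * P.map crv (CurveClass.stopAt F ⁻¹' S)) →
        P {ω | ∃ (T : ℕ) (s t : ℝ≥0), (s : ℝ) ≤ T ∧ (t : ℝ) ≤ T ∧
          μ T (dist s t) < dist (W ω s) (W ω t)} ≤ ε := by
  have hc : 0 < Real.log 2 / (2 * C) := by
    have := Real.log_pos one_lt_two
    positivity
  obtain ⟨μ, hμ, h⟩ := exists_drivingModulus_of_exitTails (fun _ ↦ (4 : ℝ))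
    (fun _ ↦ Real.log 2 / (2 * C)) (fun _ ↦ hc) hε
  refine ⟨μ, hμ, fun P _ W γ hpair hrect ↦ h P W γ hpair fun T s u hu _ hu1 L hL ↦ ?_⟩
  obtain ⟨crv, hcrv, hrep, hG⟩ := hrect s u hu hu1
  exact exitTail_of_rectangleExit P hpair hu hC crv hcrv hrep hG L hL

/-- **The driving scales `δW` of the Kemppainen–Smirnov boxes from Condition G2 in `ℍ`.** For
`C > 1` and `ε > 0` there are scales `δW k > 0` such that for every random Loewner pair with the
rectangle-exit hypothesis of `exists_drivingModulus_of_rectangleExit`, outside ONE event of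
probability `≤ ε` the driving function has the box moduli "`s, t ≤ k + 1`, `|s - t| ≤ δW k` ⟹
`|W s - W t| ≤ 1/(k+1)`" for all `k` (`Process.modulusSet`, the driving half of the boxes of
`LoewnerRegularBoxes.lean` / `DrivingProcessWeakLimitVarying.lean` and of hypothesis (2) of
`LatticeModels.FKIsingLatticeDataAssembly.exists_observableMartingale_fkInterface_of_latticeData`).
[cite: KemppainenSmirnov2017, Prop. 3.7, Prop. 3.8, Thm. 3.9 and §3.5] -/
theorem exists_drivingScales_of_rectangleExit {C : ℝ} (hC : 1 < C) {ε : ℝ≥0∞} (hε : 0 < ε) :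
    ∃ δW : ℕ → ℝ, (∀ k, 0 < δW k) ∧
      ∀ {Ω : Type u} {mΩ : MeasurableSpace Ω} (P : Measure Ω) [IsProbabilityMeasure P]
        (W : Ω → ℝ≥0 → ℝ) (γ : Ω → ℝ≥0 → ℂ),
        (∀ᵐ ω ∂P, IsGeneratedByCurve (W ω) (γ ω) ∧ IsSimpleTrace (γ ω) ∧ Continuous (W ω)) →
        (∀ s u : ℝ≥0, 0 < u → (u : ℝ) ≤ 1 → ∃ crv : Ω → CurveClass ℂ, AEMeasurable crv P ∧
          (∀ᵐ ω ∂P, (crv ω).source = 0 ∧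
            (crv ω).range = (fun r ↦ incrCurve (W ω) (γ ω) s r - W ω s) '' Icc 0 u) ∧
          ∀ F : Set ℂ, IsClosed F → F.Nonempty → ∀ (z₀ : ℝ) (S : Set (CurveClass ℂ)),
            MeasurableSet S →
            S ⊆ {p | Disjoint p.range (ball ((z₀ : ℝ) : ℂ) (C * (2 * Real.sqrt u)))} →
            P.map crv (CurveClass.stopAt F ⁻¹' S ∩
                {c | c.startFrom F ∈ CurveClass.crossingIn ((z₀ : ℝ) : ℂ) (2 * Real.sqrt u)
                  (C * (2 * Real.sqrt u)) univ}) ≤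
              2⁻¹ * P.map crv (CurveClass.stopAt F ⁻¹' S)) →
        P {ω | ∃ (k : ℕ) (s t : ℝ≥0), (s : ℝ) ≤ k + 1 ∧ (t : ℝ) ≤ k + 1 ∧ dist s t ≤ δW k ∧
          1 / ((k : ℝ) + 1) < dist (W ω s) (W ω t)} ≤ ε := by
  have hc : 0 < Real.log 2 / (2 * C) := by
    have := Real.log_pos one_lt_two
    positivity
  obtain ⟨δW, hδW, h⟩ := exists_drivingScales_of_exitTails (fun _ ↦ (4 : ℝ))
    (fun _ ↦ Real.log 2 / (2 * C)) (fun _ ↦ hc) hε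
  refine ⟨δW, hδW, fun P _ W γ hpair hrect ↦ h P W γ hpair fun T s u hu _ hu1 L hL ↦ ?_⟩
  obtain ⟨crv, hcrv, hrep, hG⟩ := hrect s u hu hu1
  exact exitTail_of_rectangleExit P hpair hu hC crv hcrv hrep hG L hL

end Bridge

end Literature.Probability.RandomPlanarGeometry
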